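import Summits.Ventures.Crystal3D.Theorems.StickyWulffConstantTextureLiminfTexShadowColumnLabel
import HarnessLib

/-!
# The column word lemma, V: the CHAIN OF A COLUMN — packaging the label propagation into `column_theorem`'s input
# (input (I5) of the terrace census; cf-p1 RULINGS (ccxxxv)(iii), (ccxli); lane T `TexShadow`, registered stub `stub_terraceCensus`, crux `TextureLiminfV5`)

HONEST FRAMING. Venture `Summits/Ventures/Crystal3D` (cell `crystal3d-full`), route `route-Ventures-StickyWulffConstant`, helper `--supports` the
law-v5 crux `TextureLiminfV5` (stmt-Ventures-23912), lane T, mechanism (β); owner of input (I5) `stub_columnWord`: 19480-p2 g15.  Census-free geometry;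
standard axioms; clean import closure (…ColumnLabel only).  Nothing about energies; F-C1 not moved.

THE POINT.  A COLUMN is a sequence `x 0, …, x M` of balls of a `1`-separated `X`, consecutive ones in contact, each with a CLOSE-PACKED contact dozen
(`IsClosePackedDozenAt`), whose first ball is ANCHORED in an affine lattice `(A₀· + t₀)''Λ₀` (lies on it, three linearly independent exact slot
neighbours) — e.g. a plate-1 ball with its dozen.  By the step lemmas of …ColumnLabel the anchoring propagates ball by ball, the affine lattice changing
exactly when the column CROSSES a mirror ball, by the affine twin step across the plane through that ball.  **`column_chain`** records this as the data
`column_theorem` (…TexShadowColumnWord) consumes: a number of steps `m`, frames `A ℓ`, origins `t ℓ`, located mirror balls `b ℓ = x (idx ℓ)` ON THE COLUMN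
and unit menu normals `n ℓ` with `A (ℓ+1) = twinFrame (A ℓ) (n ℓ)`, `t (ℓ+1) = t ℓ + 2⟪b ℓ − t ℓ, n ℓ⟫ n ℓ`, `b ℓ ∈ (A ℓ · + t ℓ)''Λ₀`, and the LAST
ball anchored in the last lamella.  With `ColumnWord.plate_matching` at the top (an `A m`-full last ball inside plate 2) and `column_theorem`, the column
realises the census's relating word letter by letter at located balls — input (I5) at configuration level, modulo the Def wording of the assembly.
WHAT THIS IS NOT: the registered Def / the assembly; F-C1 not moved.
-/

noncomputable section

namespace Summit.Ventures.Crystal3D.Theorems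

namespace ColumnWord

open Finset Summit.Ventures.Crystal3D
open Summit.Ventures.Crystal3D.Cruxes.TextureLiminf.TexShadow (E3 fccRef)
open scoped InnerProductSpace

variable {X : Finset (EuclideanSpace ℝ (Fin 3))}

/-- **ONE STEP of a column**: from a ball `y` anchored in `(A· + t)''Λ₀` with close-packed contact dozen to a contact `z` of `y`: either `z` is
anchored in the SAME affine lattice (no letter), or `y` is a mirror ball with unit menu normal `ν` of `A` and `z` is anchored in the affine twin
(`twinFrame A ν`, origin `t + 2⟪y − t, ν⟫ ν`) — one letter, crossed at the located ball `y`. -/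
theorem column_step (A : EuclideanSpace ℝ (Fin 3) ≃ₗᵢ[ℝ] EuclideanSpace ℝ (Fin 3)) {t y z : EuclideanSpace ℝ (Fin 3)}
    (hyL : y ∈ (fun r => A r + t) '' fccRef) (hy : y ∈ X) (hcp : IsClosePackedDozenAt y (X.filter fun q => dist y q = 1))
    (hanch : ∃ a ∈ fccSlots, ∃ b ∈ fccSlots, ∃ c ∈ fccSlots, LinearIndependent ℝ ![a, b, c] ∧
      y + A a ∈ X ∧ y + A b ∈ X ∧ y + A c ∈ X)
    (hz : z ∈ X) (hd : dist y z = 1) :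
    (z ∈ (fun r => A r + t) '' fccRef ∧
      ∃ a ∈ fccSlots, ∃ b ∈ fccSlots, ∃ c ∈ fccSlots, LinearIndependent ℝ ![a, b, c] ∧
        z + A a ∈ X ∧ z + A b ∈ X ∧ z + A c ∈ X) ∨
    ∃ ν : EuclideanSpace ℝ (Fin 3), ‖ν‖ = 1 ∧
      (∀ w ∈ fccSlots, ⟪A w, ν⟫_ℝ = 0 ∨ ⟪A w, ν⟫_ℝ = Real.sqrt (2 / 3) ∨ ⟪A w, ν⟫_ℝ = -Real.sqrt (2 / 3)) ∧
      z ∈ (fun r => twinFrame A ν r + (t + (2 * ⟪y - t, ν⟫_ℝ) • ν)) '' fccRef ∧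
      ∃ a ∈ fccSlots, ∃ b ∈ fccSlots, ∃ c ∈ fccSlots, LinearIndependent ℝ ![a, b, c] ∧
        z + twinFrame A ν a ∈ X ∧ z + twinFrame A ν b ∈ X ∧ z + twinFrame A ν c ∈ X := by
  obtain ⟨a, ha, b, hb, c, hc, hind, haX, hbX, hcX⟩ := hanch
  rcases fullShell_or_twinDozen_of_isClosePackedDozenAt hcp A ha hb hc hind haX hbX hcX with
    ⟨hfull, hclass⟩ | ⟨ν, hν, hmenu, hown, hmirror, -, hclass, -, -, -⟩
  · obtain ⟨w₀, hw₀, rfl⟩ := hclass z hz hd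
    exact Or.inl (anchored_of_fullShell A hyL hy hfull hw₀)
  · rcases hclass z hz hd with ⟨w₀, hw₀, hle, rfl⟩ | ⟨w₀, hw₀, hlt, rfl⟩
    · left
      rcases lt_or_eq_of_le hle with hlt | heq
      · exact anchored_of_own_polar A hyL hy hmenu hown hw₀ hlt
      · obtain ⟨h1, -, h3⟩ := anchored_of_inPlane A hyL hy hν hmenu hown hw₀ heq
        exact ⟨h1, h3⟩
    · right
      obtain ⟨heq, hmem, hanch'⟩ := anchored_of_crossing A hyL hy hν hmenu hown hmirror hw₀ hlt
      refine ⟨ν, hν, hmenu, ?_, ?_⟩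
      · rw [heq]; exact hmem
      · rw [heq]; exact hanch'

/-- **THE CHAIN OF A COLUMN.**  For a column `x 0, …, x M` (balls of `X`, consecutive contacts, close-packed contact dozens) anchored at its start in
`(A₀· + t₀)''Λ₀`: there are `m` affine twin steps with frames `A`, origins `t`, located mirror balls `b ℓ = x (idx ℓ)` (`idx ℓ ≤ M`) and unit menu
normals `n` — exactly the hypotheses of `column_theorem` — such that the last ball `x M` is anchored in the last lamella `(A m · + t m)''Λ₀`. -/
theorem column_chain (A₀ : EuclideanSpace ℝ (Fin 3) ≃ₗᵢ[ℝ] EuclideanSpace ℝ (Fin 3)) (t₀ : EuclideanSpace ℝ (Fin 3))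
    (x : ℕ → EuclideanSpace ℝ (Fin 3)) :
    ∀ M : ℕ, (∀ k ≤ M, x k ∈ X ∧ IsClosePackedDozenAt (x k) (X.filter fun q => dist (x k) q = 1)) →
      (∀ k < M, dist (x k) (x (k + 1)) = 1) →
      x 0 ∈ (fun r => A₀ r + t₀) '' fccRef →
      (∃ a ∈ fccSlots, ∃ b ∈ fccSlots, ∃ c ∈ fccSlots, LinearIndependent ℝ ![a, b, c] ∧
        x 0 + A₀ a ∈ X ∧ x 0 + A₀ b ∈ X ∧ x 0 + A₀ c ∈ X) →
      ∃ (m : ℕ) (A : ℕ → (EuclideanSpace ℝ (Fin 3) ≃ₗᵢ[ℝ] EuclideanSpace ℝ (Fin 3))) (t b n : ℕ → EuclideanSpace ℝ (Fin 3)) (idx : ℕ → ℕ),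
        A 0 = A₀ ∧ t 0 = t₀ ∧
        (∀ ℓ < m, A (ℓ + 1) = twinFrame (A ℓ) (n ℓ)) ∧
        (∀ ℓ < m, t (ℓ + 1) = t ℓ + (2 * ⟪b ℓ - t ℓ, n ℓ⟫_ℝ) • n ℓ) ∧
        (∀ ℓ < m, ‖n ℓ‖ = 1 ∧
          ∀ w ∈ fccSlots, ⟪A ℓ w, n ℓ⟫_ℝ = 0 ∨ ⟪A ℓ w, n ℓ⟫_ℝ = Real.sqrt (2 / 3) ∨ ⟪A ℓ w, n ℓ⟫_ℝ = -Real.sqrt (2 / 3)) ∧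
        (∀ ℓ < m, b ℓ ∈ (fun r => A ℓ r + t ℓ) '' fccRef) ∧
        (∀ ℓ < m, idx ℓ ≤ M ∧ b ℓ = x (idx ℓ)) ∧
        x M ∈ (fun r => A m r + t m) '' fccRef ∧
        ∃ a ∈ fccSlots, ∃ b' ∈ fccSlots, ∃ c ∈ fccSlots, LinearIndependent ℝ ![a, b', c] ∧
          x M + A m a ∈ X ∧ x M + A m b' ∈ X ∧ x M + A m c ∈ X
  | 0, _, _, h0, hanch => ⟨0, fun _ => A₀, fun _ => t₀, fun _ => 0, fun _ => 0, fun _ => 0, rfl, rfl,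
      fun ℓ hℓ => absurd hℓ (Nat.not_lt_zero ℓ), fun ℓ hℓ => absurd hℓ (Nat.not_lt_zero ℓ),
      fun ℓ hℓ => absurd hℓ (Nat.not_lt_zero ℓ), fun ℓ hℓ => absurd hℓ (Nat.not_lt_zero ℓ),
      fun ℓ hℓ => absurd hℓ (Nat.not_lt_zero ℓ), h0, hanch⟩
  | M + 1, hX, hd, h0, hanch => by
    obtain ⟨m, A, t, b, n, idx, hA0, ht0, hstep, horig, hmenu, hb, hidx, hML, hManch⟩ :=
      column_chain A₀ t₀ x M (fun k hk => hX k (Nat.le_succ_of_le hk)) (fun k hk => hd k (Nat.lt_succ_of_lt hk)) h0 hanch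
    obtain ⟨hyX, hcp⟩ := hX M (Nat.le_succ M)
    have hzX := (hX (M + 1) le_rfl).1
    rcases column_step (A m) hML hyX hcp hManch hzX (hd M (Nat.lt_succ_self M)) with ⟨hzL, hzanch⟩ | ⟨ν, hν, hνmenu, hzL, hzanch⟩
    · -- no letter: the same chain
      exact ⟨m, A, t, b, n, idx, hA0, ht0, hstep, horig, hmenu, hb, fun ℓ hℓ => ⟨(hidx ℓ hℓ).1.trans (Nat.le_succ M), (hidx ℓ hℓ).2⟩,
        hzL, hzanch⟩
    · -- one more letter, crossed at the located ball `x M`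
      refine ⟨m + 1, Function.update A (m + 1) (twinFrame (A m) ν),
        Function.update t (m + 1) (t m + (2 * ⟪x M - t m, ν⟫_ℝ) • ν),
        Function.update b m (x M), Function.update n m ν, Function.update idx m M, ?_, ?_, ?_, ?_, ?_, ?_, ?_, ?_, ?_⟩
      · rw [Function.update_of_ne (Nat.succ_ne_zero m).symm, hA0]
      · rw [Function.update_of_ne (Nat.succ_ne_zero m).symm, ht0]
      · intro ℓ hℓ
        rcases Nat.lt_succ_iff_lt_or_eq.1 hℓ with hℓ' | rfl
        · rw [Function.update_of_ne (by omega : ℓ + 1 ≠ m + 1), Function.update_of_ne (by omega : ℓ ≠ m + 1),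
            Function.update_of_ne (by omega : ℓ ≠ m)]
          exact hstep ℓ hℓ'
        · rw [Function.update_self, Function.update_of_ne (by omega : ℓ ≠ ℓ + 1), Function.update_self]
      · intro ℓ hℓ
        rcases Nat.lt_succ_iff_lt_or_eq.1 hℓ with hℓ' | rfl
        · rw [Function.update_of_ne (by omega : ℓ + 1 ≠ m + 1), Function.update_of_ne (by omega : ℓ ≠ m + 1),
            Function.update_of_ne (by omega : ℓ ≠ m), Function.update_of_ne (by omega : ℓ ≠ m)]
          exact horig ℓ hℓ'
        · rw [Function.update_self, Function.update_of_ne (by omega : ℓ ≠ ℓ + 1), Function.update_self, Function.update_self]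
      · intro ℓ hℓ
        rcases Nat.lt_succ_iff_lt_or_eq.1 hℓ with hℓ' | rfl
        · rw [Function.update_of_ne (by omega : ℓ ≠ m), Function.update_of_ne (by omega : ℓ ≠ m + 1)]
          exact hmenu ℓ hℓ'
        · rw [Function.update_self, Function.update_of_ne (by omega : ℓ ≠ ℓ + 1)]
          exact ⟨hν, hνmenu⟩
      · intro ℓ hℓ
        rcases Nat.lt_succ_iff_lt_or_eq.1 hℓ with hℓ' | rfl
        · rw [Function.update_of_ne (by omega : ℓ ≠ m), Function.update_of_ne (by omega : ℓ ≠ m + 1),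
            Function.update_of_ne (by omega : ℓ ≠ m + 1)]
          exact hb ℓ hℓ'
        · rw [Function.update_self, Function.update_of_ne (by omega : ℓ ≠ ℓ + 1), Function.update_of_ne (by omega : ℓ ≠ ℓ + 1)]
          exact hML
      · intro ℓ hℓ
        rcases Nat.lt_succ_iff_lt_or_eq.1 hℓ with hℓ' | rfl
        · rw [Function.update_of_ne (by omega : ℓ ≠ m), Function.update_of_ne (by omega : ℓ ≠ m)]
          exact ⟨(hidx ℓ hℓ').1.trans (Nat.le_succ M), (hidx ℓ hℓ').2⟩
        · rw [Function.update_self, Function.update_self]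
          exact ⟨Nat.le_succ _, rfl⟩
      · rw [Function.update_self, Function.update_self]
        exact hzL
      · rw [Function.update_self]
        exact hzanch

end ColumnWord

end Summit.Ventures.Crystal3D.Theorems

end
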